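import Summits.CriticalPhenomena.PercolationContinuityZ3.Theorems.Transplant.FKConnectivityAllQAntipodalRootFormSteps

/-!
# Connectivity correlation inequalities for `φ_{w,q}`, every `q > 0` — ROOT-FORM CALCULUS FOR ANY NUMBER OF SPECIALS, file 61α:
# pattern-indexed environment data, the nested root functional of the threshold family, and the letter rules (S), (P), (SQ)

Support file (`--supports stmt-CriticalPhenomena-4575`), FK sub-lane `prim-bschramm-fk-2` (gen 29); builds on p205010 (kernel theorem,
internal audit signed; external expert review pending).  Standard axioms, no sorries.  Memo FROM-fk-2-g29-BRIDGE.md §7–§8.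

Files 61a/61b (`…RootForm`, `…RootFormSteps`) treat environments with TWO specials `y, z`: four pattern data `d0, dy, dz, dyz`.  For the
threshold family `f_T = ω_x·OR(ω_T) ∨ AND(ω_T)` (|T| = 1 dictator, 2 `maj₃`, 3 the level-4 type `2x+y+z+w ≥ 3`, …) the root form has the SAME
shape for every `T`: sign class (−,−) at the empty pattern, (+,+) at the full pattern, (+,−) at every mixed pattern.  Here the pattern data are
indexed by `Finset ι` (`ι` = the specials inside the environment), `Gen.EDat ι`, and every identity of 61a/61b is re-proved with the mixed
sums `Σ_{∅ ≠ P ≠ univ}` in place of `dy + dz`: the per-pattern lemmas of 61a/61b (`PDat.*`) are used verbatim, only the bookkeeping of the sums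
changes.  Contents: `Gen.EDat` with `gslot1/gslot0/gandDel/gandCon/gandE1/gandE2/gtrE/gP00/gP01/gP10/grconE`, the letter maps `ser/par` and their
identities; `Gen.Env`, `Gen.gMt`, `Gen.serE/parE`; (S) `gMt_ser`, (P) `gMt_par_ge`, and the transfers `gMt_ser_nonneg`, `gMt_par_ser_nonneg`
(file 61β continues with (PQ), the AND closures and the word theorem). [folklore]
-/

noncomputable section

namespace Summit.CriticalPhenomena.PercolationContinuityZ3.Theorems

namespace FK

namespace RootForm

namespace Gen

open Finset

variable {ι : Type*} [Fintype ι] [DecidableEq ι]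

/-- Pattern-indexed data of a configuration of an environment whose specials are indexed by `ι`: for each pattern `P ⊆ ι` (the specials
in replica 1) the level and pole bits. [folklore] -/
structure EDat (ι : Type*) [Fintype ι] [DecidableEq ι] where
  /-- data at pattern `P` -/
  d : Finset ι → PDat

/-- An abstract environment with specials `ι` over a configuration type `C`. [folklore] -/
def Env (ι : Type*) [Fintype ι] [DecidableEq ι] (C : Type*) := C → EDat ι

/-- The mixed patterns `∅ ≠ P ≠ univ`. [folklore] -/
def mixed (ι : Type*) [Fintype ι] [DecidableEq ι] : Finset (Finset ι) :=
  (Finset.univ : Finset ι).powerset.filter fun P => P ≠ ∅ ∧ P ≠ Finset.univ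

namespace EDat

/-- Pattern data after a series attachment (edge in replica 1 iff `b`). [folklore] -/
def ser (b : Bool) (e : EDat ι) : EDat ι := ⟨fun P => (e.d P).ser b⟩
/-- Pattern data after a parallel attachment (edge in replica 1 iff `b`). [folklore] -/
def par (b : Bool) (e : EDat ι) : EDat ι := ⟨fun P => (e.d P).par b⟩

/-- `(e.ser b).d P = (e.d P).ser b`. [folklore] -/
@[simp] theorem ser_d (b : Bool) (e : EDat ι) (P : Finset ι) : (e.ser b).d P = (e.d P).ser b := rfl
/-- `(e.par b).d P = (e.d P).par b`. [folklore] -/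
@[simp] theorem par_d (b : Bool) (e : EDat ι) (P : Finset ι) : (e.par b).d P = (e.d P).par b := rfl

/-- Slot-1 integrand of the nested root functional: `[Λ_∅+K¹_∅ ≤ J] − [Λ_univ+K¹_univ ≤ J] + Σ_{P mixed} [Λ_P = J]K¹_P`. [folklore] -/
def gslot1 (e : EDat ι) (J : ℤ) : ℝ := (e.d ∅).a1 J - (e.d Finset.univ).a1 J + ∑ P ∈ mixed ι, (e.d P).r1 J
/-- Slot-0 integrand: `[Λ_∅+K²_∅ ≤ J] − [Λ_univ+K²_univ ≤ J] − Σ_{P mixed} [Λ_P = J]K²_P`. [folklore] -/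
def gslot0 (e : EDat ι) (J : ℤ) : ℝ := (e.d ∅).a2 J - (e.d Finset.univ).a2 J - ∑ P ∈ mixed ι, (e.d P).r2 J
/-- AND-integrand, root deleted. [folklore] -/
def gandDel (e : EDat ι) (J : ℤ) : ℝ := (e.d ∅).adel J - (e.d Finset.univ).adel J
/-- AND-integrand, root contracted. [folklore] -/
def gandCon (e : EDat ι) (J : ℤ) : ℝ := (e.d ∅).acon J - (e.d Finset.univ).acon J
/-- AND-integrand, root in replica 1. [folklore] -/
def gandE1 (e : EDat ι) (J : ℤ) : ℝ := (e.d ∅).a1 J - (e.d Finset.univ).a1 J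
/-- AND-integrand, root in replica 2. [folklore] -/
def gandE2 (e : EDat ι) (J : ℤ) : ℝ := (e.d ∅).a2 J - (e.d Finset.univ).a2 J
/-- the signed term of the parallel rule, summed over the mixed patterns. [folklore] -/
def gtrE (e : EDat ι) (J : ℤ) : ℝ := ∑ P ∈ mixed ι, (e.d P).tr J
/-- pointwise-nonnegative pieces of the parallel rule. [folklore] -/
def gP00 (e : EDat ι) (J : ℤ) : ℝ := ∑ P ∈ mixed ι, (e.d P).p00 J
/-- see `gP00`. [folklore] -/
def gP01 (e : EDat ι) (J : ℤ) : ℝ := ∑ P ∈ mixed ι, (e.d P).p01 J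
/-- see `gP00`. [folklore] -/
def gP10 (e : EDat ι) (J : ℤ) : ℝ := ∑ P ∈ mixed ι, (e.d P).p10 J
/-- `Σ_{P mixed} [Λ_P + K¹_P + K²_P = J]` (exact contracted levels, nonnegative). [folklore] -/
def grconE (e : EDat ι) (J : ℤ) : ℝ := ∑ P ∈ mixed ι, ind ((e.d P).lam + bit (e.d P).k1 + bit (e.d P).k2 = J)

variable (e : EDat ι) (J : ℤ)

/-- `0 ≤ gP00`. [folklore] -/
theorem gP00_nonneg : 0 ≤ e.gP00 J := Finset.sum_nonneg fun _ _ => PDat.p00_nonneg _ _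
/-- `0 ≤ gP01`. [folklore] -/
theorem gP01_nonneg : 0 ≤ e.gP01 J := Finset.sum_nonneg fun _ _ => PDat.p01_nonneg _ _
/-- `0 ≤ gP10`. [folklore] -/
theorem gP10_nonneg : 0 ≤ e.gP10 J := Finset.sum_nonneg fun _ _ => PDat.p10_nonneg _ _
/-- `0 ≤ gtrE`. [folklore] -/
theorem gtrE_nonneg : 0 ≤ e.gtrE J := Finset.sum_nonneg fun _ _ => PDat.tr_nonneg _ _
/-- `0 ≤ grconE`. [folklore] -/
theorem grconE_nonneg : 0 ≤ e.grconE J := Finset.sum_nonneg fun _ _ => ind_nonneg _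

/-- (S), upper section: a series edge in replica 1 leaves slot 1 unchanged. [folklore] -/
theorem gslot1_ser_true : (e.ser true).gslot1 J = e.gslot1 J := by
  simp only [gslot1, ser_d, PDat.a1_ser_true, PDat.r1_ser_true]
/-- (S): a series edge in replica 2 turns slot 1 into the deleted AND. [folklore] -/
theorem gslot1_ser_false : (e.ser false).gslot1 J = e.gandDel J := by
  simp only [gslot1, gandDel, ser_d, PDat.a1_ser_false, PDat.r1_ser_false, Finset.sum_const_zero, add_zero]
/-- (S): a series edge in replica 1 turns slot 0 into the deleted AND. [folklore] -/
theorem gslot0_ser_true : (e.ser true).gslot0 J = e.gandDel J := by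
  simp only [gslot0, gandDel, ser_d, PDat.a2_ser_true, PDat.r2_ser_true, Finset.sum_const_zero, sub_zero]
/-- (S), lower section: a series edge in replica 2 leaves slot 0 unchanged. [folklore] -/
theorem gslot0_ser_false : (e.ser false).gslot0 J = e.gslot0 J := by
  simp only [gslot0, ser_d, PDat.a2_ser_false, PDat.r2_ser_false]
/-- The deleted AND is unchanged by a series edge. [folklore] -/
theorem gandDel_ser (b : Bool) : (e.ser b).gandDel J = e.gandDel J := by simp only [gandDel, ser_d, PDat.adel_ser]
/-- Contracted AND after a series edge in replica 1 = AND with the root in replica 1. [folklore] -/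
theorem gandCon_ser_true : (e.ser true).gandCon J = e.gandE1 J := by simp only [gandCon, gandE1, ser_d, PDat.acon_ser_true]
/-- Contracted AND after a series edge in replica 2 = AND with the root in replica 2. [folklore] -/
theorem gandCon_ser_false : (e.ser false).gandCon J = e.gandE2 J := by simp only [gandCon, gandE2, ser_d, PDat.acon_ser_false]
/-- (SQ): under a series edge the signed term of the parallel rule vanishes. [folklore] -/
theorem gtrE_ser (b : Bool) : (e.ser b).gtrE J = 0 := by
  simp only [gtrE, ser_d, PDat.tr_ser, Finset.sum_const_zero]

/-- (P), sub-slot (1,1). [folklore] -/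
theorem gslot1_par_true : (e.par true).gslot1 J = e.gslot1 (J - 1) + e.gP00 J + e.gP01 J := by
  simp only [gslot1, gP00, gP01, par_d, PDat.a1_par_true, PDat.r1_par_true, Finset.sum_add_distrib]; ring
/-- (P), sub-slot (1,0): contracted AND + pointwise term + the signed term. [folklore] -/
theorem gslot1_par_false : (e.par false).gslot1 J = e.gandCon J + e.gP10 J + e.gtrE J := by
  simp only [gslot1, gandCon, gP10, gtrE, par_d, PDat.a1_par_false, PDat.r1_par_false, Finset.sum_add_distrib]; ring
/-- (P), sub-slot (0,1). [folklore] -/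
theorem gslot0_par_true : (e.par true).gslot0 J = e.gandCon J - e.gP01 J - e.gtrE J := by
  simp only [gslot0, gandCon, gP01, gtrE, par_d, PDat.a2_par_true, PDat.r2_par_true, Finset.sum_add_distrib]; ring
/-- (P), sub-slot (0,0). [folklore] -/
theorem gslot0_par_false : (e.par false).gslot0 J = e.gslot0 (J - 1) - e.gP00 J - e.gP10 J := by
  simp only [gslot0, gP00, gP10, par_d, PDat.a2_par_false, PDat.r2_par_false, Finset.sum_add_distrib]; ring

/-- (PQ), mixed sections: contracted AND one level down plus the exact contracted levels. [folklore] -/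
theorem gslot1_par_par_mixed (b : Bool) : ((e.par b).par (!b)).gslot1 J = e.gandCon (J - 1) + e.grconE J := by
  simp only [gslot1, gandCon, grconE, par_d, PDat.a1_par_par_mixed, PDat.r1_par_par_mixed]
/-- See `gslot1_par_par_mixed`. [folklore] -/
theorem gslot0_par_par_mixed (b : Bool) : ((e.par b).par (!b)).gslot0 J = e.gandCon (J - 1) - e.grconE J := by
  simp only [gslot0, gandCon, grconE, par_d, PDat.a2_par_par_mixed, PDat.r2_par_par_mixed]
/-- (PQ), equal sections: two parallel edges in one replica = one parallel edge, one level lower. [folklore] -/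
theorem gslot1_par_par_same (b : Bool) : ((e.par b).par b).gslot1 J = (e.par b).gslot1 (J - 1) := by
  simp only [gslot1, par_d, PDat.a1_par_par_same, PDat.r1_par_par_same]
/-- See `gslot1_par_par_same`. [folklore] -/
theorem gslot0_par_par_same (b : Bool) : ((e.par b).par b).gslot0 J = (e.par b).gslot0 (J - 1) := by
  simp only [gslot0, par_d, PDat.a2_par_par_same, PDat.r2_par_par_same]
/-- Deleted AND after a parallel edge in replica 1 = AND with the root in replica 1. [folklore] -/
theorem gandDel_par_true : (e.par true).gandDel J = e.gandE1 J := by simp only [gandDel, gandE1, par_d, PDat.adel_par_true]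
/-- Deleted AND after a parallel edge in replica 2 = AND with the root in replica 2. [folklore] -/
theorem gandDel_par_false : (e.par false).gandDel J = e.gandE2 J := by simp only [gandDel, gandE2, par_d, PDat.adel_par_false]
/-- Contracted AND after a parallel edge = contracted AND one level lower. [folklore] -/
theorem gandCon_par (b : Bool) : (e.par b).gandCon J = e.gandCon (J - 1) := by simp only [gandCon, par_d, PDat.acon_par]
/-- `gandE1` after a series edge in replica 1. [folklore] -/
theorem gandE1_ser_true : (e.ser true).gandE1 J = e.gandE1 J := by simp only [gandE1, ser_d, PDat.a1_ser_true]
/-- `gandE1` after a series edge in replica 2. [folklore] -/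
theorem gandE1_ser_false : (e.ser false).gandE1 J = e.gandDel J := by simp only [gandE1, gandDel, ser_d, PDat.a1_ser_false]
/-- `gandE2` after a series edge in replica 1. [folklore] -/
theorem gandE2_ser_true : (e.ser true).gandE2 J = e.gandDel J := by simp only [gandE2, gandDel, ser_d, PDat.a2_ser_true]
/-- `gandE2` after a series edge in replica 2. [folklore] -/
theorem gandE2_ser_false : (e.ser false).gandE2 J = e.gandE2 J := by simp only [gandE2, ser_d, PDat.a2_ser_false]
/-- `gandE1` after a parallel edge in replica 1. [folklore] -/
theorem gandE1_par_true : (e.par true).gandE1 J = e.gandE1 (J - 1) := by simp only [gandE1, par_d, PDat.a1_par_true]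
/-- `gandE1` after a parallel edge in replica 2. [folklore] -/
theorem gandE1_par_false : (e.par false).gandE1 J = e.gandCon J := by simp only [gandE1, gandCon, par_d, PDat.a1_par_false]
/-- `gandE2` after a parallel edge in replica 1. [folklore] -/
theorem gandE2_par_true : (e.par true).gandE2 J = e.gandCon J := by simp only [gandE2, gandCon, par_d, PDat.a2_par_true]
/-- `gandE2` after a parallel edge in replica 2. [folklore] -/
theorem gandE2_par_false : (e.par false).gandE2 J = e.gandE2 (J - 1) := by simp only [gandE2, par_d, PDat.a2_par_false]

end EDat

/-! ## Environments, the nested root functional, (S), (P), (SQ) — verbatim from file 61a with `Gen.EDat ι` -/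

section EnvLevel

variable {C : Type*} [Fintype C] [Preorder C]

/-- The environment `f · 𝓔` (fresh series edge; configurations `Bool × C`). [folklore] -/
def serE (E : Env ι C) : Env ι (Bool × C) := fun p => (E p.2).ser p.1
/-- The environment `g ∥ 𝓔` (fresh parallel edge). [folklore] -/
def parE (E : Env ι C) : Env ι (Bool × C) := fun p => (E p.2).par p.1

/-- The nested root functional `M̃_𝓔(h₀ ≤ h₁; J)` (slot 1 weighted by `h₁`, slot 0 by `h₀`). [folklore] -/
def gMt (E : Env ι C) (h0 h1 : C → ℝ) (J : ℤ) : ℝ := ∑ γ, (h1 γ * (E γ).gslot1 J + h0 γ * (E γ).gslot0 J)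

omit [Preorder C] in
/-- **(S)** The series rule. [folklore] -/
theorem gMt_ser (E : Env ι C) (H0 H1 : Bool × C → ℝ) (J : ℤ) :
    gMt (serE E) H0 H1 J = gMt E (fun γ => H0 (false, γ)) (fun γ => H1 (true, γ)) J
      + ∑ γ, H1 (false, γ) * (E γ).gandDel J + ∑ γ, H0 (true, γ) * (E γ).gandDel J := by
  unfold gMt; rw [sum_bool_prod]
  simp only [serE, EDat.gslot1_ser_true, EDat.gslot1_ser_false, EDat.gslot0_ser_true, EDat.gslot0_ser_false]
  rw [← Finset.sum_add_distrib, ← Finset.sum_add_distrib, ← Finset.sum_add_distrib]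
  exact Finset.sum_congr rfl fun γ _ => by ring

/-- **(P)** The parallel rule as an inequality (the dropped terms are pointwise nonnegative). [folklore] -/
theorem gMt_par_ge (E : Env ι C) {H0 H1 : Bool × C → ℝ} (m0 : Monotone H0) (m1 : Monotone H1) (n0 : ∀ p, 0 ≤ H0 p)
    (le : ∀ p, H0 p ≤ H1 p) (J : ℤ) :
    gMt E (fun γ => H0 (false, γ)) (fun γ => H1 (true, γ)) (J - 1)
      + ∑ γ, H1 (false, γ) * (E γ).gandCon J + ∑ γ, H0 (true, γ) * (E γ).gandCon J
      + ∑ γ, (H1 (false, γ) - H0 (true, γ)) * (E γ).gtrE J ≤ gMt (parE E) H0 H1 J := by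
  unfold gMt; rw [sum_bool_prod]
  simp only [parE, EDat.gslot1_par_true, EDat.gslot1_par_false, EDat.gslot0_par_true, EDat.gslot0_par_false]
  rw [← Finset.sum_add_distrib, ← Finset.sum_add_distrib, ← Finset.sum_add_distrib, ← Finset.sum_add_distrib]
  apply Finset.sum_le_sum; intro γ _
  have h1 := sec_le m1 γ; have h0 := sec_le m0 γ
  have ht := le (true, γ); have hf := le (false, γ); have hn := n0 (false, γ)
  nlinarith [(E γ).gP00_nonneg J, (E γ).gP01_nonneg J, (E γ).gP10_nonneg J]

/-- **(S) transfers nonnegativity.** [folklore] -/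
theorem gMt_ser_nonneg {E : Env ι C}
    (hM : ∀ h0 h1 : C → ℝ, Monotone h0 → Monotone h1 → (∀ γ, 0 ≤ h0 γ) → (∀ γ, h0 γ ≤ h1 γ) → ∀ J : ℤ, 0 ≤ gMt E h0 h1 J)
    (hd : ∀ h : C → ℝ, Monotone h → (∀ γ, 0 ≤ h γ) → ∀ J : ℤ, 0 ≤ ∑ γ, h γ * (E γ).gandDel J)
    {H0 H1 : Bool × C → ℝ} (m0 : Monotone H0) (m1 : Monotone H1) (n0 : ∀ p, 0 ≤ H0 p) (le : ∀ p, H0 p ≤ H1 p) (J : ℤ) :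
    0 ≤ gMt (serE E) H0 H1 J := by
  rw [gMt_ser]
  refine add_nonneg (add_nonneg (hM _ _ (mono_sec m0 false) (mono_sec m1 true) (fun γ => n0 _)
    (fun γ => (sec_le m0 γ).trans (le _)) J) (hd _ (mono_sec m1 false) (fun γ => (n0 _).trans (le _)) J))
    (hd _ (mono_sec m0 true) (fun γ => n0 _) J)

/-- **(SQ) transfers nonnegativity.** [folklore] -/
theorem gMt_par_ser_nonneg {E : Env ι C}
    (hM : ∀ h0 h1 : C → ℝ, Monotone h0 → Monotone h1 → (∀ γ, 0 ≤ h0 γ) → (∀ γ, h0 γ ≤ h1 γ) → ∀ J : ℤ, 0 ≤ gMt E h0 h1 J)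
    (hd : ∀ h : C → ℝ, Monotone h → (∀ γ, 0 ≤ h γ) → ∀ J : ℤ, 0 ≤ ∑ γ, h γ * (E γ).gandDel J)
    (hf : ∀ h0 h1 : C → ℝ, Monotone h0 → Monotone h1 → (∀ γ, 0 ≤ h0 γ) → (∀ γ, h0 γ ≤ h1 γ) → ∀ J : ℤ,
      0 ≤ ∑ γ, (h1 γ * (E γ).gandE1 J + h0 γ * (E γ).gandE2 J))
    {H0 H1 : Bool × (Bool × C) → ℝ} (m0 : Monotone H0) (m1 : Monotone H1) (n0 : ∀ p, 0 ≤ H0 p) (le : ∀ p, H0 p ≤ H1 p)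
    (J : ℤ) : 0 ≤ gMt (parE (serE E)) H0 H1 J := by
  refine le_trans ?_ (gMt_par_ge (serE E) m0 m1 n0 le J)
  have hvan : ∑ p : Bool × C, (H1 (false, p) - H0 (true, p)) * (serE E p).gtrE J = 0 :=
    Finset.sum_eq_zero fun p _ => by simp [serE, EDat.gtrE_ser]
  rw [hvan, add_zero]
  refine add_nonneg (add_nonneg (gMt_ser_nonneg hM hd (mono_sec m0 false) (mono_sec m1 true) (fun p => n0 _)
    (fun p => (sec_le m0 p).trans (le _)) _) ?_) ?_
  · rw [sum_bool_prod]; simp only [serE, EDat.gandCon_ser_true, EDat.gandCon_ser_false]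
    rw [← Finset.sum_add_distrib]
    exact hf _ _ (mono_sec (mono_sec m1 false) false) (mono_sec (mono_sec m1 false) true)
      (fun γ => (n0 _).trans (le _)) (fun γ => sec_le (mono_sec m1 false) γ) J
  · rw [sum_bool_prod]; simp only [serE, EDat.gandCon_ser_true, EDat.gandCon_ser_false]
    rw [← Finset.sum_add_distrib]
    exact hf _ _ (mono_sec (mono_sec m0 true) false) (mono_sec (mono_sec m0 true) true)
      (fun γ => n0 _) (fun γ => sec_le (mono_sec m0 true) γ) J

end EnvLevel

end Gen

end RootForm

end FK

end Summit.CriticalPhenomena.PercolationContinuityZ3.Theorems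

end
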